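import Literature.Probability.FitznerVanDerHofstad2017.SrwIntegralBounds
import HarnessLib

/-!
# Polynomial-kernel remainder integrals `J_n(p)` and their table-only majorant (b2b-lace, LEMMAS §20 N68d)

Build `lace`, packet node N68d (enumeration shard A).  Everything in this module is a kernel fact about
the tree's OWN objects `Dhat`, `Chat`, `P` (`Literature/Barriers/CriticalPhenomena/…`) and `srwI`
(`SrwIntegralBounds.lean`); the statements are elementary ([folklore]-tagged), programme-internal and
NOT citable as literature; no literal of any certificate is produced or consumed here.

CONTEXT (provenance only, nothing below is used as a hypothesis).  [NoBLE17-I] = R. Fitzner,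
R. van der Hofstad, *Generalized approach to the non-backtracking lace expansion*, PTRF 169 (2017),
arXiv:1506.07969, §5.3.2, (5.22)–(5.27) and the displays (Numeric-Bubble/Triangle/Square-Advanced)
(TeX l.3104–3165) bound the "long" remainder of a repulsive diagram through the trail counts `a_m(x)`
(walks never using a bond twice, TeX l.3100) and the SRW majorant `a_m ≤ (2d)^m D^{⋆m}`, giving cell
values `(2d z̄)^M Γ₂'ⁿ I_{n,M}(0)`.  Trails are non-backtracking (`TrailCounts.lean`:
`card_trailWordsTo_le_card_nbwWordsTo`, `a_m(x) ≤ b_m(x)`), and the NBW counts have the Fourier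
transform `b̂_m(k) = P_m(2d D̂(k))` for explicit polynomials `P_m` (the coefficient form of
[NoBLE17-I] §1.2.2 eq. (NBWGenSolved) `B̂_z(k) = (1-z²)/(1+(2d-1)z²-2dz D̂(k))`; Madras–Slade 1993,
Thm 5.3.1).  Replacing `(2d)^M D̂^M` by `|p(2d D̂)|` for a polynomial kernel `p` (a product of NBW
polynomials over the trail pieces) leads to the integrals `J_n(p)` below.  This module proves the ONE
lemma that turns a polynomial majorant of `|p(2d t)|` on `[-1,1]` into a bound of `J_n(p)` by the
computed (certified) moments `I_{n,j}(0) = srwI d n j 0` — verbatim the mechanism of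
`srwK_zero_le_of_majorant` — its table-only ('rig') corollary `nbwJ_le_coeff_sum_add`, in which the
only analytic input per kernel is ONE univariate polynomial inequality `p(2d t) ≥ -c/2` on `[-1,1]`
(even-degree kernels), and the kernel-comparison lemma `nbwJ_le_of_abs_le` (`|p| ≤ κ|q| + c` on
`[-1,1]` ⇒ `J_n(p) ≤ κ J_n(q) + c I_{n,0}(0)`), by which an odd-degree kernel is reduced to the even
kernel `p·X/(2d)` (reflection bound).
The NBW polynomials themselves (`nbwPoly`, with `b̂_m = P_m(2dD̂)`) live in the N68b module and are
not needed here: every statement is for an arbitrary `p : Polynomial ℝ`.  The diagrammatic step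
(trails → NBW inside (5.22)–(5.27)) is paper-level (node N68c) and is NOT asserted here.
-/

noncomputable section

open MeasureTheory Real Finset
open scoped BigOperators

namespace Literature.Probability.FitznerVanDerHofstad2017

open Literature.Barriers.CriticalPhenomena
open Literature.Barriers.CriticalPhenomena.Slade2006Prop53 (P)

variable {d : ℕ}

/-- The polynomial-kernel remainder integral `J_n(p) = ∫_{[-π,π]^d} |p(2d D̂(k))| Ĉ(k)ⁿ dk/(2π)^d`
(`Ĉ = Chat d 1 = [1 - D̂]⁻¹`; a Bochner integral, meaningful for `d ≥ 2n+1`).  For `p = X^M` this is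
`(2d)^M K_{n,M}(0)`; for `p` a product of NBW polynomials it is the NBW-kernel remainder value.
[folklore] -/
def nbwJ (d n : ℕ) (p : Polynomial ℝ) : ℝ :=
  (∫ k, |p.eval (2 * (d : ℝ) * Dhat d k)| * Chat d 1 k ^ n ∂P d) / (2 * π) ^ d

/-- `J_n(p) ≥ 0`. [folklore] -/
theorem nbwJ_nonneg (n : ℕ) (p : Polynomial ℝ) : 0 ≤ nbwJ d n p :=
  div_nonneg (integral_nonneg fun k => mul_nonneg (abs_nonneg _) (pow_nonneg (Chat_one_nonneg k) n))
    (two_pi_pow_pos d).le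

/-- `J_n(X^M) = (2d)^M K_{n,M}(0)`: the monomial kernel is the SRW remainder cell. [folklore] -/
theorem nbwJ_X_pow (n M : ℕ) :
    nbwJ d n (Polynomial.X ^ M) = (2 * (d : ℝ)) ^ M * srwK d n M 0 := by
  rw [nbwJ, srwK, ← mul_div_assoc, ← integral_const_mul]
  congr 1
  refine integral_congr_ae (ae_of_all _ fun k => ?_)
  have h2d : |2 * (d : ℝ) * Dhat d k| ^ M = (2 * (d : ℝ)) ^ M * |Dhat d k| ^ M := by
    rw [abs_mul, mul_pow, abs_of_nonneg (by positivity : (0 : ℝ) ≤ 2 * (d : ℝ))]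
  simp only [Polynomial.eval_pow, Polynomial.eval_X, abs_pow, DhatSym_zero, abs_one, mul_one]
  rw [h2d]
  ring

/-- **Polynomial-kernel majorant lemma** (the certification lever for the NBW-kernel remainders): if
`|p(2d·t)| ≤ Σ_{j ≤ N} q_j t^j` for all `t ∈ [-1,1]`, then, by positivity of `Ĉⁿ dk`,
`J_n(p) ≤ Σ_{j ≤ N} q_j I_{n,j}(0)` (`d ≥ 2n+1`); every `I_{n,j}(0)` on the right is a computed table
entry.  Same mechanism as `srwK_zero_le_of_majorant`. [folklore] -/
theorem nbwJ_le_of_majorant {n : ℕ} (hd : 2 * n + 1 ≤ d) (p : Polynomial ℝ) (N : ℕ) (q : ℕ → ℝ)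
    (hq : ∀ t ∈ Set.Icc (-1 : ℝ) 1,
      |p.eval (2 * (d : ℝ) * t)| ≤ ∑ j ∈ Finset.range (N + 1), q j * t ^ j) :
    nbwJ d n p ≤ ∑ j ∈ Finset.range (N + 1), q j * srwI d n j 0 := by
  have hI : ∀ j, Integrable (fun k => (Dhat d k ^ j * DhatSym d 0 k) * Chat d 1 k ^ n) (P d) :=
    fun j => integrable_srwI_integrand hd j 0
  have hrhs : ∑ j ∈ Finset.range (N + 1), q j * srwI d n j 0 =
      (∫ k, ∑ j ∈ Finset.range (N + 1),
        q j * ((Dhat d k ^ j * DhatSym d 0 k) * Chat d 1 k ^ n) ∂P d) / (2 * π) ^ d := by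
    rw [integral_finsetSum _ fun j _ => (hI j).const_mul (q j), Finset.sum_div]
    refine Finset.sum_congr rfl fun j _ => ?_
    rw [integral_const_mul, srwI, mul_div_assoc]
  rw [hrhs, nbwJ]
  refine div_le_div_of_nonneg_right ?_ (two_pi_pow_pos d).le
  refine integral_mono_of_nonneg (ae_of_all _ fun k => ?_)
    (integrable_finsetSum _ fun j _ => (hI j).const_mul (q j)) (ae_of_all _ fun k => ?_)
  · exact mul_nonneg (abs_nonneg _) (pow_nonneg (Chat_one_nonneg k) n)
  · have ht : Dhat d k ∈ Set.Icc (-1 : ℝ) 1 := abs_le.1 (abs_Dhat_le_one k)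
    have hmaj := hq _ ht
    have hC := pow_nonneg (Chat_one_nonneg k) n
    have e : ∑ j ∈ Finset.range (N + 1), q j * ((Dhat d k ^ j * DhatSym d 0 k) * Chat d 1 k ^ n)
        = (∑ j ∈ Finset.range (N + 1), q j * Dhat d k ^ j) * Chat d 1 k ^ n := by
      rw [Finset.sum_mul]
      refine Finset.sum_congr rfl fun j _ => ?_
      rw [DhatSym_zero]; ring
    show |p.eval (2 * (d : ℝ) * Dhat d k)| * Chat d 1 k ^ n ≤
      ∑ j ∈ Finset.range (N + 1), q j * ((Dhat d k ^ j * DhatSym d 0 k) * Chat d 1 k ^ n)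
    rw [e]
    exact mul_le_mul_of_nonneg_right hmaj hC

/-- The coefficient expansion of `p(2d·t)`: `p(2d t) = Σ_{j ≤ deg p} [p]_j (2d)^j t^j`. [folklore] -/
theorem eval_two_d_mul_eq_sum (p : Polynomial ℝ) (t : ℝ) :
    p.eval (2 * (d : ℝ) * t) =
      ∑ j ∈ Finset.range (p.natDegree + 1), p.coeff j * (2 * (d : ℝ)) ^ j * t ^ j := by
  rw [Polynomial.eval_eq_sum_range]
  refine Finset.sum_congr rfl fun j _ => ?_
  rw [mul_pow, mul_assoc]

/-- **Table-only ('rig') evaluation.**  If `p(2d t) ≥ -c/2` on `[-1,1]` with `c ≥ 0` (one univariate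
polynomial inequality per kernel), then `|p(2d t)| ≤ p(2d t) + c` there, and the majorant lemma with the
coefficients of `p(2d t)` plus the constant `c` gives
`J_n(p) ≤ Σ_{j ≤ deg p} [p]_j (2d)^j I_{n,j}(0) + c · I_{n,0}(0)` — the exact signed main term plus a
negative-part correction, every `I_{n,j}(0)` a table entry. [folklore] -/
theorem nbwJ_le_coeff_sum_add {n : ℕ} (hd : 2 * n + 1 ≤ d) (p : Polynomial ℝ) {c : ℝ} (hc : 0 ≤ c)
    (hp : ∀ t ∈ Set.Icc (-1 : ℝ) 1, -(c / 2) ≤ p.eval (2 * (d : ℝ) * t)) :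
    nbwJ d n p ≤ (∑ j ∈ Finset.range (p.natDegree + 1), p.coeff j * (2 * (d : ℝ)) ^ j * srwI d n j 0)
      + c * srwI d n 0 0 := by
  set N := p.natDegree
  set q : ℕ → ℝ := fun j => p.coeff j * (2 * (d : ℝ)) ^ j + if j = 0 then c else 0 with hq_def
  have hsplit : ∀ f : ℕ → ℝ, ∑ j ∈ Finset.range (N + 1), q j * f j =
      (∑ j ∈ Finset.range (N + 1), p.coeff j * (2 * (d : ℝ)) ^ j * f j) + c * f 0 := by
    intro f
    simp only [hq_def, add_mul, Finset.sum_add_distrib, ite_mul, zero_mul]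
    rw [Finset.sum_ite_eq' (Finset.range (N + 1)) 0 (fun j => c * f j)]
    simp
  have hmaj : ∀ t ∈ Set.Icc (-1 : ℝ) 1,
      |p.eval (2 * (d : ℝ) * t)| ≤ ∑ j ∈ Finset.range (N + 1), q j * t ^ j := by
    intro t ht
    rw [hsplit (fun j => t ^ j), pow_zero, mul_one, ← eval_two_d_mul_eq_sum]
    have h := hp t ht
    exact abs_le.2 ⟨by linarith, by linarith⟩
  have := nbwJ_le_of_majorant hd p N q hmaj
  rwa [hsplit (fun j => srwI d n j 0)] at this

/-- Crude uniform bound `|q(2d t)| ≤ Σ_{j ≤ deg q} |[q]_j| (2d)^j` on `[-1,1]`. [folklore] -/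
theorem abs_eval_two_d_mul_le (q : Polynomial ℝ) {t : ℝ} (ht : t ∈ Set.Icc (-1 : ℝ) 1) :
    |q.eval (2 * (d : ℝ) * t)| ≤
      ∑ j ∈ Finset.range (q.natDegree + 1), |q.coeff j| * (2 * (d : ℝ)) ^ j := by
  rw [eval_two_d_mul_eq_sum]
  refine (Finset.abs_sum_le_sum_abs _ _).trans (Finset.sum_le_sum fun j _ => ?_)
  rw [abs_mul, abs_mul, abs_pow, abs_pow, abs_of_nonneg (by positivity : (0 : ℝ) ≤ 2 * (d : ℝ))]
  exact mul_le_of_le_one_right (by positivity) (pow_le_one₀ (abs_nonneg t) (abs_le.2 ht))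

/-- The `J`-integrand `|q(2d D̂)| Ĉⁿ` is integrable for `d ≥ 2n+1` (bounded weight times `Ĉⁿ`).
[folklore] -/
theorem integrable_nbwJ_integrand {n : ℕ} (hd : 2 * n + 1 ≤ d) (q : Polynomial ℝ) :
    Integrable (fun k => |q.eval (2 * (d : ℝ) * Dhat d k)| * Chat d 1 k ^ n) (P d) := by
  set B : ℝ := ∑ j ∈ Finset.range (q.natDegree + 1), |q.coeff j| * (2 * (d : ℝ)) ^ j with hB
  have hB0 : 0 ≤ B := Finset.sum_nonneg fun j _ => by positivity
  have hB1 : 0 < B + 1 := by linarith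
  have hmeas : Measurable fun k : Fin d → ℝ => |q.eval (2 * (d : ℝ) * Dhat d k)| / (B + 1) :=
    ((q.continuous.comp (continuous_const.mul (continuous_Dhat d))).measurable.abs).div_const _
  have hw1 : ∀ k : Fin d → ℝ, |(|q.eval (2 * (d : ℝ) * Dhat d k)| / (B + 1))| ≤ 1 := by
    intro k
    rw [abs_div, abs_abs, abs_of_pos hB1, div_le_one hB1]
    exact (abs_eval_two_d_mul_le q (abs_le.1 (abs_Dhat_le_one k))).trans (by linarith)
  have hI := (integrable_weight_mul_Chat_pow hd hmeas hw1).const_mul (B + 1)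
  have e : (fun k => |q.eval (2 * (d : ℝ) * Dhat d k)| * Chat d 1 k ^ n) =
      fun k => (B + 1) * (|q.eval (2 * (d : ℝ) * Dhat d k)| / (B + 1) * Chat d 1 k ^ n) := by
    funext k
    field_simp
  rw [e]
  exact hI

/-- **Kernel comparison** (linearity and positivity of `J` in the kernel bound): if
`|p(2d t)| ≤ κ |q(2d t)| + c` on `[-1,1]`, then `J_n(p) ≤ κ J_n(q) + c · I_{n,0}(0)`.  This is the form
in which ODD-degree kernels are evaluated: `p` odd has a negative part of full size on `A ≤ -A₀`, but
`|p(A)| ≤ (2d/A₀)·|p(A)·A/(2d)| + c_bulk` with the EVEN kernel `p·X/(2d)` (the `e₁` kernel, all roots in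
the bulk `|A| < A₀`) and `c_bulk = sup_{|A| ≤ A₀} (|p(A)| - |A p(A)|/A₀)⁺`; the even kernel is then
bounded by `nbwJ_le_coeff_sum_add` (the "reflection bound" of the table-only evaluation). [folklore] -/
theorem nbwJ_le_of_abs_le {n : ℕ} (hd : 2 * n + 1 ≤ d) (p q : Polynomial ℝ) (κ c : ℝ)
    (h : ∀ t ∈ Set.Icc (-1 : ℝ) 1,
      |p.eval (2 * (d : ℝ) * t)| ≤ κ * |q.eval (2 * (d : ℝ) * t)| + c) :
    nbwJ d n p ≤ κ * nbwJ d n q + c * srwI d n 0 0 := by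
  have hIq := integrable_nbwJ_integrand hd q
  have hI0 : Integrable (fun k => (Dhat d k ^ 0 * DhatSym d 0 k) * Chat d 1 k ^ n) (P d) :=
    integrable_srwI_integrand hd 0 0
  have hrhs : κ * nbwJ d n q + c * srwI d n 0 0 =
      (∫ k, (κ * (|q.eval (2 * (d : ℝ) * Dhat d k)| * Chat d 1 k ^ n)
        + c * ((Dhat d k ^ 0 * DhatSym d 0 k) * Chat d 1 k ^ n)) ∂P d) / (2 * π) ^ d := by
    rw [integral_add (hIq.const_mul κ) (hI0.const_mul c), integral_const_mul, integral_const_mul,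
      nbwJ, srwI, add_div, mul_div_assoc, mul_div_assoc]
  rw [hrhs, nbwJ]
  refine div_le_div_of_nonneg_right ?_ (two_pi_pow_pos d).le
  refine integral_mono_of_nonneg (ae_of_all _ fun k => ?_)
    ((hIq.const_mul κ).add (hI0.const_mul c)) (ae_of_all _ fun k => ?_)
  · exact mul_nonneg (abs_nonneg _) (pow_nonneg (Chat_one_nonneg k) n)
  · have ht : Dhat d k ∈ Set.Icc (-1 : ℝ) 1 := abs_le.1 (abs_Dhat_le_one k)
    have hC := pow_nonneg (Chat_one_nonneg k) n
    have hmaj := mul_le_mul_of_nonneg_right (h _ ht) hC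
    have e : (κ * |q.eval (2 * (d : ℝ) * Dhat d k)| + c) * Chat d 1 k ^ n =
        κ * (|q.eval (2 * (d : ℝ) * Dhat d k)| * Chat d 1 k ^ n)
          + c * ((Dhat d k ^ 0 * DhatSym d 0 k) * Chat d 1 k ^ n) := by
      rw [DhatSym_zero, pow_zero, one_mul]
      ring
    show |p.eval (2 * (d : ℝ) * Dhat d k)| * Chat d 1 k ^ n ≤
      κ * (|q.eval (2 * (d : ℝ) * Dhat d k)| * Chat d 1 k ^ n)
        + c * ((Dhat d k ^ 0 * DhatSym d 0 k) * Chat d 1 k ^ n)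
    rw [← e]
    exact hmaj

/-- The `x = e₁` kernel (cells whose endpoint is one lattice step away): by cubic symmetry the value at
`e₁` of a symmetric summable `f` is `(f ⋆ D)(0)`, whose transform carries the extra factor
`D̂ = (2d D̂)/2d`; the corresponding remainder integral is `J_n(p · X/(2d))`, again an instance of `nbwJ`,
so `nbwJ_le_of_majorant` / `nbwJ_le_coeff_sum_add` cover it. [folklore] -/
theorem nbwJ_e1_kernel (n : ℕ) (p : Polynomial ℝ) :
    nbwJ d n (p * Polynomial.C (1 / (2 * (d : ℝ))) * Polynomial.X) =
      (∫ k, |p.eval (2 * (d : ℝ) * Dhat d k) * (1 / (2 * (d : ℝ)) * (2 * (d : ℝ) * Dhat d k))|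
        * Chat d 1 k ^ n ∂P d) / (2 * π) ^ d := by
  simp only [nbwJ, Polynomial.eval_mul, Polynomial.eval_C, Polynomial.eval_X, mul_assoc]

end Literature.Probability.FitznerVanDerHofstad2017
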